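import Mathlib
import HarnessLib
import Summits.HubbardSuperconductivity.HubbardSuperconductivity.Theorems.KLProgrammeKLRegimeEngineV8TowerParts

/-!
# Route `KLProgramme` — ENGINE (stmt-HubbardSuperconductivity-20437 `KLRegimeEngineV17F2`), stub (b) v2 (ℓ): THE TOWER PACKAGE WITH A DEFERRED c-SLOT — AMENDMENT 23 «(ℓ)-C-SLOT»
# (plan g22 (R202) path (α), leg L1, on the located check «(ℓ)-C-DOOR» — C-DOOR-CALC.md, evidence #58: the kit's λ-row needs a regime-constant threshold the tower
#  chooses itself, exactly as it chooses its U-threshold `u`; cell gate-hubbard-kl, seat hubbard-kl-k3c3-p2 g13; registrant geometry p1b g15 (G1)–(G4): NO `klEngC₃7` here —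
#  it stays in `…V8GridLiteralsPkg`, whose min-chain gains the entry `⊓ klTowerCC P R`; DefsU12b's u-chain gains `⊓ klTowerUC P R (klEngQ9c P R) cc`; ZERO image tokens)

`…V8TowerCEDefs` (p-landed, E1 g7) defers the tower's public constant and U-threshold as a package `e = (CE, u)` chosen over the tower statement
`TowerNormsStep P R Q₀ CE u`, whose regime-constant binder is the FIXED `cc ≤ klEngC₃6 P R`.  The kit's λ-row (`…TowerNumericsRegime`,
`towerNumerics_lam_le_of_doors`) splits into a U-door (served by `u`) and a c-door `2·B·Klam·cc/log 4 ≤ λ₀` that NO choice of `u` serves (`U²·n` reaches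
`cc/log 4` at every `U`); the [calc] C-DOOR-CALC.md sizes `λ₀/B` against `klEngC₃6 ≤ 2⁻¹²⁰/(klEngPsq·klEngRsq²)` as FAIL-LIKELY.  This file is the text shape of the
cure: the SAME deferral with ONE MORE component — a positive regime-constant threshold `cT` — and ONE MORE binder `cc ≤ cT`:

* §1 **`TowerNormsStepC P R Q₀ CE u cT`** — `TowerNormsStep`'s binders and conclusions VERBATIM, with `cc ≤ cT →` inserted after `cc ≤ klEngC₃6 P R →`;
  `TowerNormsStep.toC` (the c-free statement implies the c-slotted one for every `cT`), `.mono_CE`, `.anti_u`, `.anti_c`;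
* §2 **`IsTowerPkgC e`** (`0 ≤ e.1`, `∀ Q cc, 0 < e.2.1 Q cc`, `0 < e.2.2`); the DEFERRED package **`klTowerPkgC P R`** over
  `∃ e, IsTowerPkgC e ∧ TowerNormsStepC P R (klEngQ8 P R) e.1 e.2.1 e.2.2`, default `(|(klEngQ8 P R).CE|, fun _ _ => 1, 1)`; projections **`klTowerCEC`**,
  **`klTowerUC`**, **`klTowerCC`**; unconditional rows `isTowerPkgC_klTowerPkgC`, `klTowerCEC_nonneg`, `klTowerUC_pos`, `klTowerCC_pos`; the `choose_spec` rows
  `towerNormsStepC_klTowerC_of_exists/_of`; the else-branch readers.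
* §3 **`TowerLevelsStepC P R Q₀ CE u cT`** — the LEVELS part (…V8TowerParts `TowerLevelsStep`) with the same extra binder (it carries `cc ≤ klEngC₃6 P R`, and (ℓ) is
  where the c-door bites); `TowerLevelsStep.toC`; **`towerNormsStepC_of_parts`** / **`exists_towerPkgC_of_parts`** / `towerNormsStepC_klTowerC_of_parts` — the c-slotted
  levels part + the c-FREE first-moments and grid parts (unchanged predicates) assemble the c-slotted deliverable, verbatim twin of `towerNormsStep_of_parts`.
HOW (b) CLOSES WITH THE SLOT: the c-chain gets ONE entry `… ⊓ klTowerCC P R` (read by the stub's `cc ≤ klEngC₃7 P R` binder through p1b's row `klEngC₃7_le_klTowerCC`) and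
the u-chain ONE entry `⊓ klTowerUC P R (klEngQ9c P R) cc` (row `klEngU₀12_le_klTowerUC`) — both unconditionally positive; the tower theorem becomes
`∃ e, IsTowerPkgC e ∧ TowerLevelsStepC P R (klEngQ8 P R) e.1 e.2.1 e.2.2` with `e.2.2 := λ₀·log 4/(2BKlam+1)` from (I5) (`towerNumerics_cDoor_of_le`), and the closer reads
`towerNormsStepC_klTowerC_of_parts`.  Definitions with bodies + bookkeeping rows; nothing about the model is asserted; nothing asserts superconductivity.
-/

noncomputable section

namespace Summit.HubbardSuperconductivity.HubbardSuperconductivity.Theorems.EngineV8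

set_option linter.dupNamespace false -- summit = problem name (single-conjunct summit), D-0017

open Real Finset Literature.MathematicalPhysics.QuantumLattice Literature.Probability.LatticeModels
open Literature.MathematicalPhysics.QuantumLattice.FermiRG
open Summit.HubbardSuperconductivity.HubbardSuperconductivity.Theorems.KLRegimeSplit
open Summit.HubbardSuperconductivity.HubbardSuperconductivity.Theorems.KLProgrammeLegKernels
open Summit.HubbardSuperconductivity.HubbardSuperconductivity.Theorems.DispersionFlow

/-! ## §1 The tower's deliverable with a regime-constant slot -/

/-- **`TowerNormsStepC P R Q₀ CE u cT`** — `TowerNormsStep P R Q₀ CE u` with ONE more binder: the regime constant is also below the tower's own threshold,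
`cc ≤ cT` (inserted right after `cc ≤ klEngC₃6 P R`); everything else — binders and the four conclusion conjuncts — VERBATIM. -/
def TowerNormsStepC (P : SplitConsts) (R : RenConsts) (Q₀ : EngConsts) (CE : ℝ) (u : EngConsts → ℝ → ℝ) (cT : ℝ) : Prop :=
  ∀ Q : EngConsts, Q₀.IsRaiseOf Q → CE ≤ Q.CE →
    ∀ cc : ℝ, 0 < cc → cc ≤ klEngC₃6 P R → cc ≤ cT →
      ∀ μ ∈ klWindowC, ∀ U : ℝ, 0 < U → U ≤ klEngU₀10 P R cc → U ≤ u Q cc →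
        ∀ β : ℝ, klBetaMin ≤ β → β ≤ Real.exp (cc / U ^ 2) →
          ∀ (L M : ℕ) [NeZero L] [NeZero M], klEngL₄ P R β U ≤ L → klEngM₃ β U L ≤ M →
            ∀ n : ℕ, 1 ≤ n → n ≤ nScales β + 1 → IsKLRegime U cc (-(n : ℤ)) →
              HistP klPredsV17F2 L M klEngGeo8 P Q R β U μ 0 n →
                FrameOK R U (nScales β) μ (klFlowFrameU L M β U μ n) →
                  (∀ j ≤ n, LevelsUExportMixedAt L M (klCU2 P R (klEngQ7 P R)) P β U μ j) →
                    KernelNormsV4 L M P Q β U μ (klFlowFrameU L M β U μ n) n ∧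
                      (∀ j ≤ n, (KernelNormsLevels L M P Q β U μ (klFlowFrameU L M β U μ n) j ∧
                        KernelNormsWt4 L M (klWtBudget P Q U j) β U μ (klFlowFrameU L M β U μ n) j)) ∧
                      EngineFirstMoments L M klEngGeo8 P Q β U μ (klFlowFrameU L M β U μ n) n ∧
                      TwoLegGridFlowMomentsAt L M ((2 : ℝ) ^ 10 * Real.exp 1 ^ 18 * Real.sqrt (2 * (7 + 1606732)) ^ 4 * klE3Acum R)
                        ((2 : ℝ) ^ 11 * Real.exp 1 ^ 18 * Real.sqrt (2 * (7 + 1606732)) ^ 4 * klE3Acum R) β U μ n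

/-- **The c-free deliverable implies the c-slotted one for every threshold** (the extra binder is simply not used). -/
theorem TowerNormsStep.toC {P : SplitConsts} {R : RenConsts} {Q₀ : EngConsts} {CE : ℝ} {u : EngConsts → ℝ → ℝ}
    (h : TowerNormsStep P R Q₀ CE u) (cT : ℝ) : TowerNormsStepC P R Q₀ CE u cT :=
  fun Q hQ hCE cc hcc hcc6 _ => h Q hQ hCE cc hcc hcc6

/-- `TowerNormsStepC` is monotone in the candidate constant (fewer raises qualify). -/
theorem TowerNormsStepC.mono_CE {P : SplitConsts} {R : RenConsts} {Q₀ : EngConsts} {CE CE' : ℝ} {u : EngConsts → ℝ → ℝ} {cT : ℝ}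
    (h : TowerNormsStepC P R Q₀ CE u cT) (hle : CE ≤ CE') : TowerNormsStepC P R Q₀ CE' u cT :=
  fun Q hQ hCE => h Q hQ (hle.trans hCE)

/-- `TowerNormsStepC` is antitone in the U-threshold. -/
theorem TowerNormsStepC.anti_u {P : SplitConsts} {R : RenConsts} {Q₀ : EngConsts} {CE : ℝ} {u u' : EngConsts → ℝ → ℝ} {cT : ℝ}
    (h : TowerNormsStepC P R Q₀ CE u cT) (hle : ∀ Q cc, u' Q cc ≤ u Q cc) : TowerNormsStepC P R Q₀ CE u' cT :=
  fun Q hQ hCE cc hcc hcc6 hccT μ hμ U hU hU10 hUu => h Q hQ hCE cc hcc hcc6 hccT μ hμ U hU hU10 (hUu.trans (hle Q cc))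

/-- `TowerNormsStepC` is antitone in the c-threshold (a smaller `cT' ≤ cT` only removes regime constants). -/
theorem TowerNormsStepC.anti_c {P : SplitConsts} {R : RenConsts} {Q₀ : EngConsts} {CE : ℝ} {u : EngConsts → ℝ → ℝ} {cT cT' : ℝ}
    (h : TowerNormsStepC P R Q₀ CE u cT) (hle : cT' ≤ cT) : TowerNormsStepC P R Q₀ CE u cT' :=
  fun Q hQ hCE cc hcc hcc6 hccT => h Q hQ hCE cc hcc hcc6 (hccT.trans hle)

/-! ## §2 The deferred package with the c-slot, its projections and rows -/

/-- **An admissible c-slotted tower package**: nonnegative constant, U-threshold positive everywhere, c-threshold positive. -/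
def IsTowerPkgC (e : ℝ × (EngConsts → ℝ → ℝ) × ℝ) : Prop := 0 ≤ e.1 ∧ (∀ Q cc, 0 < e.2.1 Q cc) ∧ 0 < e.2.2

/-- The default package `(|Q₀.CE|, 1, 1)` is admissible for every `Q₀`. -/
theorem isTowerPkgC_default (Q₀ : EngConsts) : IsTowerPkgC (|Q₀.CE|, fun _ _ => 1, 1) :=
  ⟨abs_nonneg _, fun _ _ => one_pos, one_pos⟩

/-- An admissible c-free package extends to an admissible c-slotted one with any positive `cT` (and the same deliverable, `TowerNormsStep.toC`). -/
theorem isTowerPkgC_of_isTowerPkg {e : ℝ × (EngConsts → ℝ → ℝ)} (he : IsTowerPkg e) {cT : ℝ} (hcT : 0 < cT) :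
    IsTowerPkgC (e.1, e.2, cT) := ⟨he.1, he.2, hcT⟩

section Deferred

variable (P : SplitConsts) (R : RenConsts)

/-- **The deferred c-slotted tower package `klTowerPkgC P R`**: SOME admissible `(CE, u, cT)` for which `TowerNormsStepC P R (klEngQ8 P R) CE u cT` holds,
if one exists, ELSE the default `(|(klEngQ8 P R).CE|, fun _ _ => 1, 1)` (well formed in both branches: nonnegative constant, positive thresholds). -/
def klTowerPkgC : ℝ × (EngConsts → ℝ → ℝ) × ℝ :=
  open scoped Classical in
  if h : ∃ e : ℝ × (EngConsts → ℝ → ℝ) × ℝ, IsTowerPkgC e ∧ TowerNormsStepC P R (klEngQ8 P R) e.1 e.2.1 e.2.2 then Classical.choose h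
  else (|(klEngQ8 P R).CE|, fun _ _ => 1, 1)

/-- **The tower's public constant with the c-slot**, `klTowerCEC P R := (klTowerPkgC P R).1`. -/
def klTowerCEC : ℝ := (klTowerPkgC P R).1

/-- **The tower's CE-aware coupling threshold with the c-slot**, `klTowerUC P R := (klTowerPkgC P R).2.1` (a u-chain entry `⊓ klTowerUC P R Q cc`). -/
def klTowerUC : EngConsts → ℝ → ℝ := (klTowerPkgC P R).2.1

/-- **The tower's regime-constant threshold**, `klTowerCC P R := (klTowerPkgC P R).2.2` (the c-chain entry `⊓ klTowerCC P R`). -/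
def klTowerCC : ℝ := (klTowerPkgC P R).2.2

/-- The deferred c-slotted package is admissible (unconditionally). -/
theorem isTowerPkgC_klTowerPkgC : IsTowerPkgC (klTowerPkgC P R) := by
  classical
  unfold klTowerPkgC
  split_ifs with h
  · exact (Classical.choose_spec h).1
  · exact isTowerPkgC_default _

/-- `0 ≤ klTowerCEC P R` (unconditionally). -/
theorem klTowerCEC_nonneg : 0 ≤ klTowerCEC P R := (isTowerPkgC_klTowerPkgC P R).1

/-- `0 < klTowerUC P R Q cc` (unconditionally). -/
theorem klTowerUC_pos (Q : EngConsts) (cc : ℝ) : 0 < klTowerUC P R Q cc := (isTowerPkgC_klTowerPkgC P R).2.1 Q cc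

/-- `0 < klTowerCC P R` (unconditionally) — so a c-chain `… ⊓ klTowerCC P R` stays positive. -/
theorem klTowerCC_pos : 0 < klTowerCC P R := (isTowerPkgC_klTowerPkgC P R).2.2

/-- `klTowerCEC P R ≤ max (klEngQ8 P R).CE (klTowerCEC P R)` (what a closer feeds as `CE ≤ Q.CE` at the B′ table constant). -/
theorem klTowerCEC_le_max_klEngQ8_CE : klTowerCEC P R ≤ max (klEngQ8 P R).CE (klTowerCEC P R) := le_max_right _ _

variable {P R}

/-- **The c-slotted deliverable holds for the deferred package as soon as it holds for some admissible package** (`choose_spec`). -/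
theorem towerNormsStepC_klTowerC_of_exists
    (h : ∃ e : ℝ × (EngConsts → ℝ → ℝ) × ℝ, IsTowerPkgC e ∧ TowerNormsStepC P R (klEngQ8 P R) e.1 e.2.1 e.2.2) :
    TowerNormsStepC P R (klEngQ8 P R) (klTowerCEC P R) (klTowerUC P R) (klTowerCC P R) := by
  classical
  have hpkg : klTowerPkgC P R = Classical.choose h := by
    unfold klTowerPkgC
    rw [dif_pos h]
  unfold klTowerCEC klTowerUC klTowerCC
  rw [hpkg]
  exact (Classical.choose_spec h).2

/-- Packaging an explicit witness `(CE, u, cT)`. -/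
theorem towerNormsStepC_klTowerC_of {CE : ℝ} {u : EngConsts → ℝ → ℝ} {cT : ℝ} (hCE : 0 ≤ CE) (hu : ∀ Q cc, 0 < u Q cc) (hcT : 0 < cT)
    (hs : TowerNormsStepC P R (klEngQ8 P R) CE u cT) :
    TowerNormsStepC P R (klEngQ8 P R) (klTowerCEC P R) (klTowerUC P R) (klTowerCC P R) :=
  towerNormsStepC_klTowerC_of_exists ⟨(CE, u, cT), ⟨hCE, hu, hcT⟩, hs⟩

/-- The c-free tower theorem (if it is ever proved in the form `…TowerCEDefs` expects) also feeds the c-slotted package (with `cT := 1`). -/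
theorem towerNormsStepC_klTowerC_of_exists_cfree
    (h : ∃ e : ℝ × (EngConsts → ℝ → ℝ), IsTowerPkg e ∧ TowerNormsStep P R (klEngQ8 P R) e.1 e.2) :
    TowerNormsStepC P R (klEngQ8 P R) (klTowerCEC P R) (klTowerUC P R) (klTowerCC P R) := by
  obtain ⟨e, he, hs⟩ := h
  exact towerNormsStepC_klTowerC_of he.1 he.2 one_pos (hs.toC 1)

/-- **ELSE branch**: with no admissible witness the deferred package IS the default. -/
theorem klTowerPkgC_of_not_exists
    (h : ¬ ∃ e : ℝ × (EngConsts → ℝ → ℝ) × ℝ, IsTowerPkgC e ∧ TowerNormsStepC P R (klEngQ8 P R) e.1 e.2.1 e.2.2) :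
    klTowerPkgC P R = (|(klEngQ8 P R).CE|, fun _ _ => 1, 1) := by
  classical
  unfold klTowerPkgC
  rw [dif_neg h]

/-- ELSE branch, constant. -/
theorem klTowerCEC_of_not_exists
    (h : ¬ ∃ e : ℝ × (EngConsts → ℝ → ℝ) × ℝ, IsTowerPkgC e ∧ TowerNormsStepC P R (klEngQ8 P R) e.1 e.2.1 e.2.2) :
    klTowerCEC P R = |(klEngQ8 P R).CE| := by
  unfold klTowerCEC; rw [klTowerPkgC_of_not_exists h]

/-- ELSE branch, U-threshold. -/
theorem klTowerUC_of_not_exists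
    (h : ¬ ∃ e : ℝ × (EngConsts → ℝ → ℝ) × ℝ, IsTowerPkgC e ∧ TowerNormsStepC P R (klEngQ8 P R) e.1 e.2.1 e.2.2) :
    klTowerUC P R = fun _ _ => 1 := by
  unfold klTowerUC; rw [klTowerPkgC_of_not_exists h]

/-- ELSE branch, c-threshold. -/
theorem klTowerCC_of_not_exists
    (h : ¬ ∃ e : ℝ × (EngConsts → ℝ → ℝ) × ℝ, IsTowerPkgC e ∧ TowerNormsStepC P R (klEngQ8 P R) e.1 e.2.1 e.2.2) :
    klTowerCC P R = 1 := by
  unfold klTowerCC; rw [klTowerPkgC_of_not_exists h]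

end Deferred

/-! ## §3 The levels part with the c-slot and the parts assembly (twin of …V8TowerParts §1–§2) -/

/-- **`TowerLevelsStepC P R Q₀ CE u cT`** — `TowerLevelsStep P R Q₀ CE u` (…V8TowerParts) with ONE more binder `cc ≤ cT` right after `cc ≤ klEngC₃6 P R`;
conclusion verbatim: at every tower level `1 ≤ j ≤ n`, `KernelNormsLevels … (K_n) j ∧ KernelNormsWt4 (klWtBudget P Q U j) … (K_n) j`. -/
def TowerLevelsStepC (P : SplitConsts) (R : RenConsts) (Q₀ : EngConsts) (CE : ℝ) (u : EngConsts → ℝ → ℝ) (cT : ℝ) : Prop :=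
  ∀ Q : EngConsts, Q₀.IsRaiseOf Q → CE ≤ Q.CE →
    ∀ cc : ℝ, 0 < cc → cc ≤ klEngC₃6 P R → cc ≤ cT →
      ∀ μ ∈ klWindowC, ∀ U : ℝ, 0 < U → U ≤ klEngU₀10 P R cc → U ≤ u Q cc →
        ∀ β : ℝ, klBetaMin ≤ β → β ≤ Real.exp (cc / U ^ 2) →
          ∀ (L M : ℕ) [NeZero L] [NeZero M], klEngL₄ P R β U ≤ L → klEngM₃ β U L ≤ M →
            ∀ n : ℕ, 1 ≤ n → n ≤ nScales β + 1 → IsKLRegime U cc (-(n : ℤ)) →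
              HistP klPredsV17F2 L M klEngGeo8 P Q R β U μ 0 n →
                FrameOK R U (nScales β) μ (klFlowFrameU L M β U μ n) →
                  (∀ j ≤ n, LevelsUExportMixedAt L M (klCU2 P R (klEngQ7 P R)) P β U μ j) →
                    ∀ j : ℕ, 1 ≤ j → j ≤ n →
                      KernelNormsLevels L M P Q β U μ (klFlowFrameU L M β U μ n) j ∧
                        KernelNormsWt4 L M (klWtBudget P Q U j) β U μ (klFlowFrameU L M β U μ n) j

/-- The c-free levels part implies the c-slotted one for every threshold. -/
theorem TowerLevelsStep.toC {P : SplitConsts} {R : RenConsts} {Q₀ : EngConsts} {CE : ℝ} {u : EngConsts → ℝ → ℝ}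
    (h : TowerLevelsStep P R Q₀ CE u) (cT : ℝ) : TowerLevelsStepC P R Q₀ CE u cT :=
  fun Q hQ hCE cc hcc hcc6 _ => h Q hQ hCE cc hcc hcc6

/-- `TowerLevelsStepC` is monotone in `CE`, antitone in `u` and in `cT`. -/
theorem TowerLevelsStepC.mono {P : SplitConsts} {R : RenConsts} {Q₀ : EngConsts} {CE CE' : ℝ} {u u' : EngConsts → ℝ → ℝ} {cT cT' : ℝ}
    (h : TowerLevelsStepC P R Q₀ CE u cT) (hCE : CE ≤ CE') (hu : ∀ Q cc, u' Q cc ≤ u Q cc) (hc : cT' ≤ cT) :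
    TowerLevelsStepC P R Q₀ CE' u' cT' :=
  fun Q hQ hCE' cc hcc hcc6 hccT μ hμ U hU hU10 hUu =>
    h Q hQ (hCE.trans hCE') cc hcc hcc6 (hccT.trans hc) μ hμ U hU hU10 (hUu.trans (hu Q cc))

section Assembly

variable {P : SplitConsts} {R : RenConsts} {Q₀ : EngConsts}

/-- **PARTS ASSEMBLY WITH THE c-SLOT** (twin of `towerNormsStep_of_parts`): the c-slotted levels part at `(CEℓ, uℓ, cT)` and the c-FREE first-moments and grid parts
at `(CE₄, u₄)`, `(CEg, ug)` give `TowerNormsStepC P R Q₀ (max CEℓ (max CE₄ CEg)) (uℓ ⊓ u₄ ⊓ ug) cT` — level `0` from the scale-0 rung exactly as in …V8TowerParts. -/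
theorem towerNormsStepC_of_parts {CEℓ CE₄ CEg : ℝ} {uℓ u₄ ug : EngConsts → ℝ → ℝ} {cT : ℝ} (hP : P.WF) (hR : R.WF2)
    (hQ₀ : (klEngQ7 P R).IsRaiseOf Q₀)
    (hℓ : TowerLevelsStepC P R Q₀ CEℓ uℓ cT) (h₄ : TowerFirstMomentsStep P R Q₀ CE₄ u₄) (hg : TowerGridMomentsStep P R Q₀ CEg ug) :
    TowerNormsStepC P R Q₀ (max CEℓ (max CE₄ CEg)) (fun Q cc => min (uℓ Q cc) (min (u₄ Q cc) (ug Q cc))) cT := by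
  intro Q hQ hCE cc hcc hcc6 hccT μ hμ U hU hU10 hUu β hβ hβc L M _ _ hL hM n hn1 hn hreg hhist hfr hlevU
  have hCEℓ : CEℓ ≤ Q.CE := (le_max_left _ _).trans hCE
  have hCE₄ : CE₄ ≤ Q.CE := ((le_max_left _ _).trans (le_max_right _ _)).trans hCE
  have hCEg : CEg ≤ Q.CE := ((le_max_right _ _).trans (le_max_right _ _)).trans hCE
  have hUℓ : U ≤ uℓ Q cc := hUu.trans (min_le_left _ _)
  have hU₄ : U ≤ u₄ Q cc := hUu.trans ((min_le_right _ _).trans (min_le_left _ _))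
  have hUg : U ≤ ug Q cc := hUu.trans ((min_le_right _ _).trans (min_le_right _ _))
  have hβ0 : 0 ≤ β := le_trans (by norm_num [klBetaMin]) hβ
  -- level 0: the scale-0 rung at the frame `K_n`, along the raise `klEngQ7 → Q₀ → Q`
  have h0 := levelZero_norms_frame_of_isRaiseOf_U10L4 P R Q (hQ₀.trans hQ) cc hP hR hcc hcc6 μ hμ U hU hU10 β hβ hβc
    (klFlowFrameU L M β U μ n) hfr L M hL hM
  have hlev : ∀ j ≤ n, KernelNormsLevels L M P Q β U μ (klFlowFrameU L M β U μ n) j ∧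
      KernelNormsWt4 L M (klWtBudget P Q U j) β U μ (klFlowFrameU L M β U μ n) j := by
    intro j hj
    rcases Nat.eq_zero_or_pos j with rfl | hj1
    · exact ⟨h0.2.1, h0.2.2⟩
    · exact hℓ Q hQ hCEℓ cc hcc hcc6 hccT μ hμ U hU hU10 hUℓ β hβ hβc L M hL hM n hn1 hn hreg hhist hfr hlevU j hj1 hj
  refine ⟨kernelNormsV4_of_kernelNormsWt4_klWtBudget hβ0 (hlev n le_rfl).2, hlev, ?_, ?_⟩
  · exact h₄ Q hQ hCE₄ cc hcc hcc6 μ hμ U hU hU10 hU₄ β hβ hβc L M hL hM n hn1 hn hreg hhist hfr hlevU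
  · exact hg Q hQ hCEg cc hcc hcc6 μ hμ U hU hU10 hUg β hβ hβc L M hL hM n hn1 hn hreg hhist hfr hlevU

/-- **`∃`-form with the c-slot**: an admissible c-slotted package for the levels part and admissible c-free packages for the other two parts give an admissible
c-slotted package for the whole deliverable. -/
theorem exists_towerPkgC_of_parts (hP : P.WF) (hR : R.WF2) (hQ₀ : (klEngQ7 P R).IsRaiseOf Q₀)
    (hℓ : ∃ e : ℝ × (EngConsts → ℝ → ℝ) × ℝ, IsTowerPkgC e ∧ TowerLevelsStepC P R Q₀ e.1 e.2.1 e.2.2)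
    (h₄ : ∃ e : ℝ × (EngConsts → ℝ → ℝ), IsTowerPkg e ∧ TowerFirstMomentsStep P R Q₀ e.1 e.2)
    (hg : ∃ e : ℝ × (EngConsts → ℝ → ℝ), IsTowerPkg e ∧ TowerGridMomentsStep P R Q₀ e.1 e.2) :
    ∃ e : ℝ × (EngConsts → ℝ → ℝ) × ℝ, IsTowerPkgC e ∧ TowerNormsStepC P R Q₀ e.1 e.2.1 e.2.2 := by
  obtain ⟨⟨CEℓ, uℓ, cT⟩, ⟨hℓ0, hℓu, hℓc⟩, hℓ⟩ := hℓ
  obtain ⟨⟨CE₄, u₄⟩, ⟨h₄0, h₄u⟩, h₄⟩ := h₄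
  obtain ⟨⟨CEg, ug⟩, ⟨_, hgu⟩, hg⟩ := hg
  exact ⟨(max CEℓ (max CE₄ CEg), fun Q cc => min (uℓ Q cc) (min (u₄ Q cc) (ug Q cc)), cT),
    ⟨le_max_of_le_left hℓ0, fun Q cc => lt_min (hℓu Q cc) (lt_min (h₄u Q cc) (hgu Q cc)), hℓc⟩,
    towerNormsStepC_of_parts hP hR hQ₀ hℓ h₄ hg⟩

/-- **Straight into the deferred c-slotted package's row**: the three part packages at `klEngQ8 P R` ⇒
`TowerNormsStepC P R (klEngQ8 P R) (klTowerCEC P R) (klTowerUC P R) (klTowerCC P R)`. -/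
theorem towerNormsStepC_klTowerC_of_parts (hP : P.WF) (hR : R.WF2)
    (hℓ : ∃ e : ℝ × (EngConsts → ℝ → ℝ) × ℝ, IsTowerPkgC e ∧ TowerLevelsStepC P R (klEngQ8 P R) e.1 e.2.1 e.2.2)
    (h₄ : ∃ e : ℝ × (EngConsts → ℝ → ℝ), IsTowerPkg e ∧ TowerFirstMomentsStep P R (klEngQ8 P R) e.1 e.2)
    (hg : ∃ e : ℝ × (EngConsts → ℝ → ℝ), IsTowerPkg e ∧ TowerGridMomentsStep P R (klEngQ8 P R) e.1 e.2) :
    TowerNormsStepC P R (klEngQ8 P R) (klTowerCEC P R) (klTowerUC P R) (klTowerCC P R) :=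
  towerNormsStepC_klTowerC_of_exists (exists_towerPkgC_of_parts hP hR (isRaiseOf_klEngQ8 P R) hℓ h₄ hg)

end Assembly

end Summit.HubbardSuperconductivity.HubbardSuperconductivity.Theorems.EngineV8

end
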